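import Summits.QuantumFields.BalabanUV.T4Continuum.Support.NE7EtaHolderJunction
import Summits.QuantumFields.BalabanUV.T4Continuum.Support.NE7EtaCurlFromCovGradient
import HarnessLib

/-!
# NE7EtaRatesD4Holder — route #1 of the NE7 crux (node U5), socket `h` AMENDMENT 5 (ROAD-G106 §4): the COVARIANT-GRADIENT RATE of the
# background coordinate at `d = 4` from the energy rate (E), (Lip₁ᶜ) and the HÖLDER-½ hypothesis (Höl½ᶜ) along lattice lines — in place of
# gen 22's (Lip₂′ᶜ) (`NE7EtaRatesD4Cov.norm_covDiff_le_rate`); rate base `θ^{18} = L⁻¹` so that every exponent stays integral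

Cell `pub-balaban`, rung (B)+1 sub-cell t4, lineage `b2b-balaban-t4-ne7-p1`, generation 106 (CRUX PROVER NE7 #1 = OWNER of BINDER row NE7).
Memo `t4/b2b-balaban-t4-ne7-p1-g106/ROAD-G106.md` §4.

WHAT ([folklore]; 0 def, 0 sorry).  `θ^{18} = L⁻¹` (so `ϑ := θ³` has `ϑ⁶ = L⁻¹` and gen 22's lemmas apply verbatim with `ϑ`), `ξ = (L⁻¹)^k = θ^{18k}`; ONE
`N L^k`-periodic pair `(W, Z)` on `ℤ⁴`, `W` unitary; (E) `L^k·energyNormW ≤ γ³`; FIT `γ(ϑ^k)² ≤ l₁N`; (Lip₁ᶜ) `‖Ad (W (x+e κ) μ) (Z (x+e μ) κ) − Z x κ‖ ≤ Λ₁ξ²`,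
`Λ₁ ≤ l₁³`; and (Höl½ᶜ): along the `μ`-line through `y + e κ`, the covariant first differences `D(y)` transported back with the line holonomy
`H_j = ∏_{i<j} W (y + e κ + i•e μ) μ` satisfy `‖Ad H_j (D(y + j•e μ)) − D(y)‖ ≤ Λ_H·√j·ξ²·√ξ` for all `j` (`Λ_H ≥ 0`; the [Balaban1985RegularSpaces]
Thm 2 (1.36) `‖A‖_{1,½}` SHAPE, read on the lattice of level `k`).  Then
 * `scale18_eq` — `ξ = θ^{18k}`, `√ξ = θ^{9k}`;  `norm_dir_le_rate_holder` — (P) `‖Z x κ‖ ≤ 8l₁²γ·θ^{24k}` (gen 22's `norm_dir_le_rate_cov` at `ϑ`);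
 * **`norm_covDiff_le_rate_holder`** — (Gᶜ) `‖Ad (W (x+e κ) μ) (Z (x+e μ) κ) − Z x κ‖ ≤ (16l₁²γ + √2·Λ_H)·θ^{38k}`
   (`NE7EtaHolderJunction.norm_covDiff_le_of_holderHalf_real` with `M = 8l₁²γθ^{24k}`, `Hc = Λ_Hθ^{45k}`, `t = θ^{−14k}`);
 * `norm_curl_le_rate_holder` — (C) `‖d_W Z (x, π)‖ ≤ 2(16l₁²γ + √2·Λ_H)·θ^{38k}`.
In the reading of NODE O (`max(L^k·sup‖Z‖, L^{2k}·sup‖∇_W Z‖)`, `L^k = θ^{−18k}`): `θ^{6k}` and `θ^{2k}` — geometric, as `uRateUpTo_tower` wants.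
HONEST FRAMING (page 1): bookkeeping over `NE7EtaHolderJunction` + `NE7EtaRatesD4Cov` ([folklore]); hypotheses on ONE pair; nothing of NE3∕NE7 discharged;
the amendment's re-threading of the END chain is NOT done here; nothing of Bałaban's asserted as an axiom; spine count = dagwriter∕referees' call;
FIXED FINITE T⁴, rung (B)+1 — NOT infinite volume, NOT mass gap, NOT BetaPertH, NOT Clay.
-/

set_option autoImplicit false

open scoped BigOperators Matrix Matrix.Norms.L2Operator
open Finset

namespace Summit.QuantumFields.BalabanUV.T4Continuum.NE7EtaRatesD4Holder

open Literature.MathematicalPhysics.QuantumFieldTheory.Balaban1983to89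
open B7Prop1Explicit B7Prop2Explicit
open T4AveragingDeficitWall hiding Site Plane Plaq Bond
open T4AveragingDeficitWallBoundary (periodBox IsPeriodicCfg)
open AveragingDeficitPeriodicCounting (IsPeriodicDir)
open NE3EnergyWeightedShapes (energyNormW energyNormW_nonneg)
open NE7EtaRatesD4 (scale_eq scale_le_half)
open NE7EtaRatesD4Cov (norm_dir_le_rate_cov)
open NE7EtaCurlFromCovGradient (norm_curl_le_two_mul_of_covDiff)
open NE7EtaHolderJunction (norm_covDiff_le_of_holderHalf_real)

noncomputable section

variable {n : Type*} [Fintype n] [DecidableEq n]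

/-! ## §1 The base `θ^{18} = L⁻¹` -/

/-- `θ^{18} = L⁻¹` ⟹ `ϑ := θ³` satisfies `ϑ⁶ = L⁻¹`. [folklore] -/
theorem cube_pow_six {L : ℕ} {θ : ℝ} (hθ18 : θ ^ 18 = ((L : ℝ))⁻¹) : (θ ^ 3) ^ 6 = ((L : ℝ))⁻¹ := by
  rw [← pow_mul]; exact hθ18

/-- `θ^{18} = L⁻¹`, `θ > 0` ⟹ `ξ = (L⁻¹)^k = θ^{18k}` and `√ξ = θ^{9k}`. [folklore] -/
theorem scale18_eq {L : ℕ} (hL : 1 ≤ L) {θ : ℝ} (hθ : 0 < θ) (hθ18 : θ ^ 18 = ((L : ℝ))⁻¹) (k : ℕ) :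
    ((L : ℝ)⁻¹) ^ k = θ ^ (18 * k) ∧ Real.sqrt (((L : ℝ)⁻¹) ^ k) = θ ^ (9 * k) := by
  obtain ⟨h1, -⟩ := scale_eq hL (cube_pow_six hθ18) k
  have e : ((L : ℝ)⁻¹) ^ k = θ ^ (18 * k) := by
    rw [h1, ← pow_mul, ← pow_mul]; ring_nf
  refine ⟨e, ?_⟩
  rw [e, show θ ^ (18 * k) = (θ ^ (9 * k)) ^ 2 by rw [← pow_mul]; ring_nf, Real.sqrt_sq (by positivity)]

/-- `θ^{18} = L⁻¹`, `L ≥ 2`, `θ > 0` ⟹ `θ ≤ 1`. [folklore] -/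
theorem theta_le_one {L : ℕ} (hL : 2 ≤ L) {θ : ℝ} (hθ : 0 < θ) (hθ18 : θ ^ 18 = ((L : ℝ))⁻¹) : θ ≤ 1 := by
  obtain ⟨-, h⟩ := scale_le_half hL (pow_pos hθ 3) (cube_pow_six hθ18) (le_refl 1)
  rw [pow_one] at h
  by_contra hc
  push Not at hc
  have : 1 < θ ^ 3 := one_lt_pow₀ hc (by norm_num)
  linarith

/-! ## §2 The rates -/

/-- **(P) THE POTENTIAL COORDINATE** at base `θ^{18} = L⁻¹`: `‖Z x κ‖ ≤ 8l₁²γ·θ^{24k}` — gen 22's `norm_dir_le_rate_cov` at `ϑ = θ³`. [folklore] -/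
theorem norm_dir_le_rate_holder {L N k : ℕ} (hL : 2 ≤ L) (hN : 1 ≤ N) (hk : 1 ≤ k) {θ : ℝ} (hθ : 0 < θ)
    (hθ18 : θ ^ 18 = ((L : ℝ))⁻¹) {W : Site 4 → Fin 4 → (Matrix n n ℂ)ˣ} {Z : Site 4 → Fin 4 → Matrix n n ℂ}
    (hWu : IsUnitaryCfg W) (hWP : IsPeriodicCfg W ((N * L ^ k : ℕ) : ℤ)) (hZP : IsPeriodicDir Z ((N * L ^ k : ℕ) : ℤ))
    {γ Λ₁ l₁ : ℝ} (hγ : 0 < γ) (hl₁ : 0 < l₁) (hΛl : Λ₁ ≤ l₁ ^ 3)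
    (hE : (L : ℝ) ^ k * energyNormW L k W Z (periodBox (d := 4) (N * L ^ k)) ≤ γ ^ 3)
    (hlipc : ∀ (κ : Fin 4) (x : Site 4) (μ : Fin 4), ‖Ad (W (x + e κ) μ) (Z (x + e μ) κ) - Z x κ‖ ≤ Λ₁ * (((L : ℝ)⁻¹) ^ k) ^ 2)
    (hfit : γ * ((θ ^ 3) ^ k) ^ 2 ≤ l₁ * N) (x : Site 4) (κ : Fin 4) :
    ‖Z x κ‖ ≤ 8 * l₁ ^ 2 * γ * θ ^ (24 * k) := by
  have h := norm_dir_le_rate_cov hL hN hk (pow_pos hθ 3) (cube_pow_six hθ18) hWu hWP hZP hγ hl₁ hΛl hE hlipc hfit x κ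
  have e : (θ ^ 3) ^ (8 * k) = θ ^ (24 * k) := by rw [← pow_mul]; ring_nf
  rw [e] at h
  exact h

/-- **(Gᶜ) THE COVARIANT-GRADIENT COORDINATE FROM (E) + (Lip₁ᶜ) + (Höl½ᶜ)**: statement in the file header. [folklore] -/
theorem norm_covDiff_le_rate_holder {L N k : ℕ} (hL : 2 ≤ L) (hN : 1 ≤ N) (hk : 1 ≤ k) {θ : ℝ} (hθ : 0 < θ)
    (hθ18 : θ ^ 18 = ((L : ℝ))⁻¹) {W : Site 4 → Fin 4 → (Matrix n n ℂ)ˣ} {Z : Site 4 → Fin 4 → Matrix n n ℂ}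
    (hWu : IsUnitaryCfg W) (hWP : IsPeriodicCfg W ((N * L ^ k : ℕ) : ℤ)) (hZP : IsPeriodicDir Z ((N * L ^ k : ℕ) : ℤ))
    {γ Λ₁ l₁ ΛH : ℝ} (hγ : 0 < γ) (hl₁ : 0 < l₁) (hΛl : Λ₁ ≤ l₁ ^ 3) (hΛH : 0 ≤ ΛH)
    (hE : (L : ℝ) ^ k * energyNormW L k W Z (periodBox (d := 4) (N * L ^ k)) ≤ γ ^ 3)
    (hlipc : ∀ (κ : Fin 4) (x : Site 4) (μ : Fin 4), ‖Ad (W (x + e κ) μ) (Z (x + e μ) κ) - Z x κ‖ ≤ Λ₁ * (((L : ℝ)⁻¹) ^ k) ^ 2)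
    (hhol : ∀ (κ μ : Fin 4) (y : Site 4) (j : ℕ),
      ‖Ad (((List.range j).map fun i : ℕ => W (y + e κ + i • e μ) μ).prod)
            (Ad (W (y + j • e μ + e κ) μ) (Z (y + j • e μ + e μ) κ) - Z (y + j • e μ) κ)
          - (Ad (W (y + e κ) μ) (Z (y + e μ) κ) - Z y κ)‖
        ≤ ΛH * Real.sqrt (j : ℝ) * (((L : ℝ)⁻¹) ^ k) ^ 2 * Real.sqrt (((L : ℝ)⁻¹) ^ k))
    (hfit : γ * ((θ ^ 3) ^ k) ^ 2 ≤ l₁ * N) (x : Site 4) (μ κ : Fin 4) :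
    ‖Ad (W (x + e κ) μ) (Z (x + e μ) κ) - Z x κ‖ ≤ (16 * l₁ ^ 2 * γ + Real.sqrt 2 * ΛH) * θ ^ (38 * k) := by
  have hL1 : 1 ≤ L := by omega
  obtain ⟨hξ, hsξ⟩ := scale18_eq hL1 hθ hθ18 k
  have hθ1 : θ ≤ 1 := theta_le_one hL hθ hθ18
  -- the sup letter (P) and the Hölder letter in the `θ`-currency
  set M : ℝ := 8 * l₁ ^ 2 * γ * θ ^ (24 * k) with hMdef
  have hM0 : 0 ≤ M := by positivity
  have hsup : ∀ y, ‖Z y κ‖ ≤ M := fun y =>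
    norm_dir_le_rate_holder hL hN hk hθ hθ18 hWu hWP hZP hγ hl₁ hΛl hE hlipc hfit y κ
  set Hc : ℝ := ΛH * θ ^ (45 * k) with hHcdef
  have hHc0 : 0 ≤ Hc := by positivity
  have hhol' : ∀ (y : Site 4) (j : ℕ),
      ‖Ad (((List.range j).map fun i : ℕ => W (y + e κ + i • e μ) μ).prod)
            (Ad (W (y + j • e μ + e κ) μ) (Z (y + j • e μ + e μ) κ) - Z (y + j • e μ) κ)
          - (Ad (W (y + e κ) μ) (Z (y + e μ) κ) - Z y κ)‖ ≤ Hc * Real.sqrt (j : ℝ) := by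
    intro y j
    have h := hhol κ μ y j
    rw [hsξ, hξ] at h
    have e : ΛH * Real.sqrt (j : ℝ) * (θ ^ (18 * k)) ^ 2 * θ ^ (9 * k) = Hc * Real.sqrt (j : ℝ) := by
      rw [hHcdef]; ring
    rw [e] at h
    exact h
  -- the parameter `t = θ^{−14k} ≥ 1`
  set t : ℝ := (θ ^ (14 * k))⁻¹ with htdef
  have hθ14 : 0 < θ ^ (14 * k) := by positivity
  have hθ14le : θ ^ (14 * k) ≤ 1 := pow_le_one₀ hθ.le hθ1
  have ht1 : 1 ≤ t := by rw [htdef]; exact one_le_inv_iff₀.mpr ⟨hθ14, hθ14le⟩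
  have ht0 : 0 < t := by linarith
  have h := norm_covDiff_le_of_holderHalf_real hWu κ μ hM0 hHc0 hsup hhol' ht1 x
  -- `2M/t = 16 l₁²γ θ^{38k}`
  have e1 : 2 * M / t = 16 * l₁ ^ 2 * γ * θ ^ (38 * k) := by
    rw [hMdef, htdef, div_inv_eq_mul, show θ ^ (38 * k) = θ ^ (24 * k) * θ ^ (14 * k) by rw [← pow_add]; ring_nf]
    ring
  -- `Hc √(t+1) ≤ Hc √(2t) = √2 Λ_H θ^{38k}`
  have hsqt : Real.sqrt t = (θ ^ (7 * k))⁻¹ := by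
    rw [htdef, show θ ^ (14 * k) = (θ ^ (7 * k)) ^ 2 by rw [← pow_mul]; ring_nf, Real.sqrt_inv, Real.sqrt_sq (by positivity)]
  have e2 : Hc * Real.sqrt (2 * t) = Real.sqrt 2 * ΛH * θ ^ (38 * k) := by
    rw [Real.sqrt_mul (by norm_num : (0 : ℝ) ≤ 2), hsqt, hHcdef,
      show θ ^ (45 * k) = θ ^ (38 * k) * θ ^ (7 * k) by rw [← pow_add]; ring_nf]
    have hθ7 : θ ^ (7 * k) ≠ 0 := pow_ne_zero _ hθ.ne'
    field_simp
  have h2 : Hc * Real.sqrt (t + 1) ≤ Hc * Real.sqrt (2 * t) :=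
    mul_le_mul_of_nonneg_left (Real.sqrt_le_sqrt (by linarith)) hHc0
  calc ‖Ad (W (x + e κ) μ) (Z (x + e μ) κ) - Z x κ‖ ≤ 2 * M / t + Hc * Real.sqrt (t + 1) := h
    _ ≤ 16 * l₁ ^ 2 * γ * θ ^ (38 * k) + Real.sqrt 2 * ΛH * θ ^ (38 * k) := by rw [← e1, ← e2]; linarith
    _ = (16 * l₁ ^ 2 * γ + Real.sqrt 2 * ΛH) * θ ^ (38 * k) := by ring

/-- **(C) THE CURL COORDINATE** from (Gᶜ): `‖d_W Z (x, π)‖ ≤ 2(16l₁²γ + √2·Λ_H)·θ^{38k}`. [folklore] -/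
theorem norm_curl_le_rate_holder {L N k : ℕ} (hL : 2 ≤ L) (hN : 1 ≤ N) (hk : 1 ≤ k) {θ : ℝ} (hθ : 0 < θ)
    (hθ18 : θ ^ 18 = ((L : ℝ))⁻¹) {W : Site 4 → Fin 4 → (Matrix n n ℂ)ˣ} {Z : Site 4 → Fin 4 → Matrix n n ℂ}
    (hWu : IsUnitaryCfg W) (hWP : IsPeriodicCfg W ((N * L ^ k : ℕ) : ℤ)) (hZP : IsPeriodicDir Z ((N * L ^ k : ℕ) : ℤ))
    {γ Λ₁ l₁ ΛH : ℝ} (hγ : 0 < γ) (hl₁ : 0 < l₁) (hΛl : Λ₁ ≤ l₁ ^ 3) (hΛH : 0 ≤ ΛH)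
    (hE : (L : ℝ) ^ k * energyNormW L k W Z (periodBox (d := 4) (N * L ^ k)) ≤ γ ^ 3)
    (hlipc : ∀ (κ : Fin 4) (x : Site 4) (μ : Fin 4), ‖Ad (W (x + e κ) μ) (Z (x + e μ) κ) - Z x κ‖ ≤ Λ₁ * (((L : ℝ)⁻¹) ^ k) ^ 2)
    (hhol : ∀ (κ μ : Fin 4) (y : Site 4) (j : ℕ),
      ‖Ad (((List.range j).map fun i : ℕ => W (y + e κ + i • e μ) μ).prod)
            (Ad (W (y + j • e μ + e κ) μ) (Z (y + j • e μ + e μ) κ) - Z (y + j • e μ) κ)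
          - (Ad (W (y + e κ) μ) (Z (y + e μ) κ) - Z y κ)‖
        ≤ ΛH * Real.sqrt (j : ℝ) * (((L : ℝ)⁻¹) ^ k) ^ 2 * Real.sqrt (((L : ℝ)⁻¹) ^ k))
    (hfit : γ * ((θ ^ 3) ^ k) ^ 2 ≤ l₁ * N) (π : T4AveragingDeficitWall.Plane 4) (x : Site 4) :
    ‖curl W Z (x, π)‖ ≤ 2 * ((16 * l₁ ^ 2 * γ + Real.sqrt 2 * ΛH) * θ ^ (38 * k)) :=
  norm_curl_le_two_mul_of_covDiff hWu
    (fun κ x μ => norm_covDiff_le_rate_holder hL hN hk hθ hθ18 hWu hWP hZP hγ hl₁ hΛl hΛH hE hlipc hhol hfit x μ κ) π x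

end

end Summit.QuantumFields.BalabanUV.T4Continuum.NE7EtaRatesD4Holder
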